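import Literature.NumberTheory.LFunctions.ConreyIwaniec2002Thm61GenericPairSums
import HarnessLib

/-!
# Conrey–Iwaniec (2002), Theorem 6.1, generic part (6.4)–(6.12): `𝒜(T) = L(0)TG + 2T Re Σ_{h≤H} S*(h) + O(G₁/T + G₂/(TH) + (Σ|a_n|)²/T³)`

B. Conrey, H. Iwaniec, *Spacing of zeros of Hecke `L`-functions and the class number problem*,
Acta Arith. 103 (2002) 259–312, §6 (6.4)–(6.12) [held text `paper:arxiv-math_0111012`, p0014]:
"`𝒜(T) = L(0)TG + 2T Re Σ_{0<h≤H} S*(h) + O(G + T⁻¹G₁ + T⁻¹H⁻¹G₂)` (6.12)."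

PROVED HERE: **`ConreyIwaniec2002.thm61_generic : ∃ c : ℝ, 0 < c ∧ Thm61Generic c`** — the
registered sub-stub S2a `stub_thm61_generic` of SKELETON P64 (line `thm61-cm-convolution`, cell
landau-siegel/ls-inputs) VERBATIM, with `c = 64`; `Thm61Generic` is the interface of
`ConreyIwaniec2002MeanValueDefs.lean` ((6.4)–(6.12) for an admissible kernel and any sequence with
`a₀ = 0`, `Σ n²|a_n|² < ∞`, every `T > 0`, `H ≥ 1`). Assembly (`Thm61GenericPart.abs_sub_main_le`):
the identity (6.5) (`…Thm61GenericIdentity`), the truncated main term as a double series and the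
three pair sums (`…Thm61GenericPairSums`), the pointwise bound (`…Thm61GenericBounds`):
`|𝒜 − L(0)TG − 2T Re Σ_{h≤H}S*(h)| = 2T|Re(U − M)| ≤ 2T(16T⁻¹·G₁/T + 32T⁻⁴(Σ|a_n|)² + 4G₂/(T²H))
≤ 64(G₁/T + G₂/(TH) + (Σ|a_n|)²/T³)`. Compared with the printed (6.12): no `G` term (the row sum
`Σ_{h≥1}(1+hT/n)⁻² ≤ n/T` is used exactly), and the terms `n < h`, where the Taylor step (6.7) does
not apply, are carried by `(Σ|a_n|)²/T³` (the source's `T⁻³Y^{9/4}` at (6.31)).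

«The programme SEARCHES and TYPES; no claim about Landau–Siegel zeros, Theorems 1–2 of
arXiv:2211.02515 or a repaired Margin232 until a kernel theorem says so.»

## References
* [ConreyIwaniec2002] B. Conrey, H. Iwaniec, *Spacing of zeros of Hecke L-functions and the class
  number problem*, Acta Arith. 103 (2002) 259–312, arXiv:math/0111012: §5 (5.14)–(5.18), §6 (6.1)–(6.12).
-/

noncomputable section

open Complex MeasureTheory Set Filter Real Finset
open scoped ComplexConjugate

namespace Literature.NumberTheory.LFunctions

namespace ConreyIwaniec2002

namespace Thm61GenericPart

open Thm61OffDiagSeries (abs_ciL_le_one)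

/-! ### Assembly: (6.12) with `c = 64` -/

section Assembly

variable {K : ℝ → ℝ} (hK : IsCIKernel K) {a : ℕ → ℂ} (ha0 : a 0 = 0)
  (hG : Summable fun n : ℕ => (n : ℝ) ^ 2 * ‖a n‖ ^ 2) {T : ℝ} (hT : 0 < T) {H : ℕ} (hH : 1 ≤ H)
include hK ha0 hG hT hH

/-- **(6.12) with the explicit constant `64`**:
`|𝒜(T) − L(0)TG − 2T Re Σ_{h ≤ H} S*(h)| ≤ 64 (G₁/T + G₂/(TH) + (Σ|a_n|)²/T³)`.
[cite: ConreyIwaniec2002, §6 (6.5)–(6.12)] -/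
theorem abs_sub_main_le :
    |(∫ t : ℝ, K (t / T) * ‖LSeries a (t * I)‖ ^ 2) - ciL K 0 * T * (∑' n : ℕ, ‖a n‖ ^ 2) -
        2 * T * (∑ h ∈ Finset.Icc 1 H, ∑' n : ℕ,
          a (n + h) * starRingEnd ℂ (a n) * (ciL K (h * T / n) : ℂ)).re| ≤
      64 * ((∑' n : ℕ, (n : ℝ) * ‖a n‖ ^ 2) / T +
        (∑' n : ℕ, (n : ℝ) ^ 2 * ‖a n‖ ^ 2) / (T * H) + (∑' n : ℕ, ‖a n‖) ^ 2 / T ^ 3) := by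
  -- the two pair families
  set u : ℕ × ℕ → ℂ := fun q => a (q.2 + 1 + (q.1 + 1)) * conj (a (q.2 + 1)) *
    (ciL K (T * (Real.log (q.2 + 1 + (q.1 + 1) : ℕ) - Real.log (q.2 + 1 : ℕ))) : ℂ) with hu
  set m : ℕ × ℕ → ℂ := fun q => if q.1 + 1 ≤ H then
      a (q.2 + 1 + (q.1 + 1)) * conj (a (q.2 + 1)) *
        (ciL K (((q.1 + 1 : ℕ) : ℝ) * T / ((q.2 + 1 : ℕ) : ℝ)) : ℂ) else 0 with hm
  rw [integral_kernel_normSq_eq_diag_add_offdiag hK ha0 hG hT,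
    sum_shiftedSum_eq_tsum_pair hK ha0 hG T H]
  have hus : Summable u := by
    refine Summable.of_norm_bounded (tsum_pair_le_sq ha0 hG).1 (fun q => ?_)
    simp only [hu]
    rw [norm_mul, norm_mul, Complex.norm_conj, Complex.norm_real, Real.norm_eq_abs]
    exact mul_le_of_le_one_right (by positivity) (abs_ciL_le_one hK _)
  have hms : Summable m := summable_mainPair hK ha0 hG T H
  -- the majorant
  set maj : ℕ × ℕ → ℝ := fun q => ‖a (q.2 + 1 + (q.1 + 1))‖ * ‖a (q.2 + 1)‖ *
    (16 * T⁻¹ * ((1 + ((q.1 : ℝ) + 1) * T / ((q.2 : ℝ) + 1)) ^ 2)⁻¹ + 32 * (T ^ 4)⁻¹ +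
      (if H < q.1 + 1 then 4 * ((q.2 : ℝ) + 1) ^ 2 / ((((q.1 : ℝ) + 1)) * T) ^ 2 else 0))
    with hmaj
  have hpt : ∀ q : ℕ × ℕ, ‖u q - m q‖ ≤ maj q := by
    intro q
    have hD := abs_ciL_diff_le hK hT H (h := q.1 + 1) (n := q.2 + 1) (by omega) (by omega)
    have hfac : u q - m q = a (q.2 + 1 + (q.1 + 1)) * conj (a (q.2 + 1)) *
        ((ciL K (T * (Real.log ((q.2 + 1 + (q.1 + 1) : ℕ) : ℝ) - Real.log ((q.2 + 1 : ℕ) : ℝ))) -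
          (if q.1 + 1 ≤ H then ciL K (((q.1 + 1 : ℕ) : ℝ) * T / ((q.2 + 1 : ℕ) : ℝ)) else 0)
            : ℝ) : ℂ) := by
      simp only [hu, hm]
      split_ifs <;> push_cast <;> ring
    rw [hfac, norm_mul, norm_mul, Complex.norm_conj, Complex.norm_real, Real.norm_eq_abs]
    simp only [hmaj]
    refine mul_le_mul_of_nonneg_left ?_ (by positivity)
    refine hD.trans (le_of_eq ?_)
    push_cast
    ring
  obtain ⟨hf1s, hf1⟩ := tsum_pair_weight_le ha0 hG hT
  obtain ⟨hf2s, hf2⟩ := tsum_pair_tail_le hG hT hH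
  obtain ⟨hf3s, hf3⟩ := tsum_pair_le_sq ha0 hG
  have hmaj_eq : ∀ q : ℕ × ℕ, maj q =
      16 * T⁻¹ * (‖a (q.2 + 1 + (q.1 + 1))‖ * ‖a (q.2 + 1)‖ *
          ((1 + ((q.1 : ℝ) + 1) * T / ((q.2 : ℝ) + 1)) ^ 2)⁻¹) +
        32 * (T ^ 4)⁻¹ * (‖a (q.2 + 1 + (q.1 + 1))‖ * ‖a (q.2 + 1)‖) +
        ‖a (q.2 + 1 + (q.1 + 1))‖ * ‖a (q.2 + 1)‖ *
          (if H < q.1 + 1 then 4 * ((q.2 : ℝ) + 1) ^ 2 / ((((q.1 : ℝ) + 1)) * T) ^ 2 else 0) := by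
    intro q; simp only [hmaj]; ring
  have hmajs : Summable maj := by
    refine (((hf1s.mul_left (16 * T⁻¹)).add (hf3s.mul_left (32 * (T ^ 4)⁻¹))).add hf2s).congr
      fun q => (hmaj_eq q).symm
  have hmaj_sum : ∑' q, maj q ≤ 16 * T⁻¹ * ((∑' n : ℕ, (n : ℝ) * ‖a n‖ ^ 2) / T) +
      32 * (T ^ 4)⁻¹ * (∑' n : ℕ, ‖a n‖) ^ 2 +
        4 * (∑' n : ℕ, (n : ℝ) ^ 2 * ‖a n‖ ^ 2) / (T ^ 2 * H) := by
    rw [tsum_congr hmaj_eq, ((hf1s.mul_left _).add (hf3s.mul_left _)).tsum_add hf2s,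
      (hf1s.mul_left _).tsum_add (hf3s.mul_left _), tsum_mul_left, tsum_mul_left]
    gcongr
  -- the difference of the two pair sums
  have hnorm : ‖(∑' q, u q) - ∑' q, m q‖ ≤ ∑' q, maj q := by
    rw [← hus.tsum_sub hms]
    have hns : Summable fun q => ‖u q - m q‖ :=
      Summable.of_nonneg_of_le (fun _ => norm_nonneg _) hpt hmajs
    exact (norm_tsum_le_tsum_norm hns).trans (hns.tsum_le_tsum hpt hmajs)
  have hre : |(∑' q, u q).re - (∑' q, m q).re| ≤ ∑' q, maj q := by
    rw [← Complex.sub_re]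
    exact (Complex.abs_re_le_norm _).trans hnorm
  -- conclude
  have hG1nn : 0 ≤ ∑' n : ℕ, (n : ℝ) * ‖a n‖ ^ 2 := tsum_nonneg fun n => by positivity
  have hG2nn : 0 ≤ ∑' n : ℕ, (n : ℝ) ^ 2 * ‖a n‖ ^ 2 := tsum_nonneg fun n => by positivity
  have hS0nn : 0 ≤ (∑' n : ℕ, ‖a n‖) ^ 2 := sq_nonneg _
  have hHr : (1 : ℝ) ≤ H := by exact_mod_cast hH
  have hkey : |2 * T * (∑' q, u q).re - 2 * T * (∑' q, m q).re| ≤ 2 * T * ∑' q, maj q := by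
    rw [← mul_sub, abs_mul, abs_of_pos (by positivity)]
    exact mul_le_mul_of_nonneg_left hre (by positivity)
  calc |ciL K 0 * T * (∑' n : ℕ, ‖a n‖ ^ 2) + 2 * T * (∑' q, u q).re -
          ciL K 0 * T * (∑' n : ℕ, ‖a n‖ ^ 2) - 2 * T * (∑' q, m q).re|
      = |2 * T * (∑' q, u q).re - 2 * T * (∑' q, m q).re| := by ring_nf
    _ ≤ 2 * T * ∑' q, maj q := hkey
    _ ≤ 2 * T * (16 * T⁻¹ * ((∑' n : ℕ, (n : ℝ) * ‖a n‖ ^ 2) / T) +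
          32 * (T ^ 4)⁻¹ * (∑' n : ℕ, ‖a n‖) ^ 2 +
          4 * (∑' n : ℕ, (n : ℝ) ^ 2 * ‖a n‖ ^ 2) / (T ^ 2 * H)) :=
        mul_le_mul_of_nonneg_left hmaj_sum (by positivity)
    _ = 32 * ((∑' n : ℕ, (n : ℝ) * ‖a n‖ ^ 2) / T) + 64 * ((∑' n : ℕ, ‖a n‖) ^ 2 / T ^ 3) +
          8 * ((∑' n : ℕ, (n : ℝ) ^ 2 * ‖a n‖ ^ 2) / (T * H)) := by
        field_simp
        ring
    _ ≤ 64 * ((∑' n : ℕ, (n : ℝ) * ‖a n‖ ^ 2) / T +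
          (∑' n : ℕ, (n : ℝ) ^ 2 * ‖a n‖ ^ 2) / (T * H) + (∑' n : ℕ, ‖a n‖) ^ 2 / T ^ 3) := by
        have h1 : 0 ≤ (∑' n : ℕ, (n : ℝ) * ‖a n‖ ^ 2) / T := by positivity
        have h2 : 0 ≤ (∑' n : ℕ, (n : ℝ) ^ 2 * ‖a n‖ ^ 2) / (T * H) := by positivity
        have h3 : 0 ≤ (∑' n : ℕ, ‖a n‖) ^ 2 / T ^ 3 := by positivity
        nlinarith

end Assembly

end Thm61GenericPart

/-- **Conrey–Iwaniec (2002), (6.4)–(6.12) — the generic part of Theorem 6.1** (registered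
sub-stub S2a `stub_thm61_generic` of SKELETON P64, interface `Thm61Generic`), with `c = 64`:
for an admissible kernel `K` and any sequence with `a₀ = 0`, `Σ n²|a_n|² < ∞`, `T > 0`, `H ≥ 1`,
`|∫K(t/T)|Σ a_n n^{-it}|²dt − L(0)TG − 2T Re Σ_{h≤H} S*(h)| ≤ 64(G₁/T + G₂/(TH) + (Σ|a_n|)²/T³)`.
[cite: ConreyIwaniec2002, §6 (6.4)–(6.12)] -/
theorem thm61_generic : ∃ c : ℝ, 0 < c ∧ Thm61Generic c :=
  ⟨64, by norm_num, fun _K hK _a ha0 hG _T hT _H hH =>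
    Thm61GenericPart.abs_sub_main_le hK ha0 hG hT hH⟩

end ConreyIwaniec2002

end Literature.NumberTheory.LFunctions

end
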